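import Literature.Probability.Percolation.MarkedLoopBoundarySpanCriterion
import Literature.Probability.LatticeModels.TemperleyLiebPercolationHeadInitial
import HarnessLib

/-!
# Boundary span from stability under the CORNER-PAIR generators only («BSPAN-CORNER-CRITERION»)

Topic `Literature/Probability/Percolation`; generic-`k` layer of the marked-loop (Khristoforov–Smirnov) lineage; a rider on `MarkedLoopBoundarySpanCriterion.lean`
(«BSPAN-STABILITY-CRITERION»: `bNonvanish_of_laws_stable` — stability of the span of the boundary laws under ALL generators `e_0, …, e_{k−1}` of the `(k+1)`-site planar module)
and `LatticeModels/TemperleyLiebPercolationHeadInitial.lean` («TL-PERCOLATION-HEAD-INITIAL»: ★★ `span_eq_top_of_stable_initial` — at loop weight `1` the INITIAL generators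
`e_0, …, e_{k−2}` (those not touching the last site) already generate the planar module from any vector of non-zero total mass).

In the home-arc law `lawLP z : LinkPattern (k+1) →₀ ℂ` the boundary mid-edge `z` is the LAST site `Fin.last k` (`closeUpRel`), and the corners `u_0, …, u_{k−1}` are the sites
`0, …, k−1`; the generator `e_j` for `j ≤ k−2` acts on the pair of consecutive CORNERS `(u_j, u_{j+1})`, and only `e_{k−1}` touches `z`. Hence:

* ★★★ `bNonvanish_of_laws_stable_corners` / `bSpan_of_laws_stable_corners` — **BOUNDARY NON-DEGENERACY / SPAN (`k = 2m+1`, home arc) ⟸ for every CORNER PAIR `(u_j, u_{j+1})`,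
  `j ≤ k−2`, and every home-arc boundary mid-edge `z` of every `k`-marked domain, `e_j · lawLP z` lies in the span of the boundary laws, and one pattern is realised** —
  the generator at `z` is NOT needed; ★★ `bSpan_of_laws_stable_corners'` — the same on every arc (`k = 2m+3`).

This is the form the lane's hexagon-tower surgery addresses (HOME `FINDING-BSPAN-TOWER-IDENTITY.md`: towers act on pairs of consecutive corners).

## References
* M. Khristoforov, S. Smirnov, *Percolation and O(1) loop model*, arXiv:2111.15612 (2021), §1.2 (arXiv v1 p. 2), §2 Lemma 4 (p. 4), eq. (4) and Remark 6 (p. 5).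
* D. Ridout, Y. Saint-Aubin, Adv. Theor. Math. Phys. 18 (2014) = arXiv:1204.4505, §3 Prop. 3.3 (arXiv p. 13).
* P. A. Pearce, V. Rittenberg, J. de Gier, B. Nienhuis, J. Phys. A 35 (2002) L661–L668, §2.

## Mathlib / tree
Tree: `MarkedLoopBoundarySpanCriterion` (`totalMass_lawLP_ne_zero`), `MarkedLoopBoundaryLawModule` (`lawLP`, `bNonvanish_last_iff_span_lawLP`), `MarkedLoopBoundarySpan`
(`ArcPoint`, `BSpan`, `BNonvanish`, `bSpan_iff_bNonvanish`, `bNonvanish_iff`), `LatticeModels/TemperleyLiebPercolationHeadInitial` (`span_eq_top_of_stable_initial`).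
-/

open Finset

namespace Literature.Probability.Percolation.MarkedLoops

open Literature.Probability.Percolation Literature.Probability.LatticeModels
open Literature.Probability.LatticeModels.TemperleyLieb
open TriMarkedDomain

section CornerCriterion

variable {m : ℕ}

/-- ★★★ **THE CORNER-PAIR STABILITY CRITERION FOR BOUNDARY NON-DEGENERACY** (`k = 2m+1` marks, home arc): stability of the span of the boundary laws under the generators
`e_j`, `j ≤ k−2 = 2m−1` — those acting on pairs of consecutive corners — together with one realised pattern gives `BNonvanish k` on the home arc.
[cite: KhristoforovSmirnov2021, §2 Lemma 4 (arXiv v1 p. 4), eq. (4) and Remark 6 (p. 5); RidoutSaintAubin2014TL, §3 Prop. 3.3 (arXiv p. 13); PearceRittenbergDeGierNienhuis2002, §2] -/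
theorem bNonvanish_of_laws_stable_corners
    (hstab : ∀ (j : Fin (2 * m + 1)), j.val < 2 * m → ∀ (D : TriMarkedDomain (2 * m + 1)) (z : ArcPoint D (Fin.last (2 * m))),
      tlL ℂ 1 j (lawLP z) ∈ Submodule.span ℂ (Set.range fun zz : (Σ D : TriMarkedDomain (2 * m + 1), ArcPoint D (Fin.last (2 * m))) => lawLP zz.2))
    (h0 : ∃ (D : TriMarkedDomain (2 * m + 1)) (z : ArcPoint D (Fin.last (2 * m))) (q : Pat₀ (2 * m + 1)), patternCount D z.v z.i q.1 ≠ 0) :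
    BNonvanish (2 * m + 1) (Fin.last (2 * m)) := by
  obtain ⟨D₀, z₀, q₀, hq₀⟩ := h0
  rw [bNonvanish_last_iff_span_lawLP]
  exact span_eq_top_of_stable_initial (fun zz : (Σ D : TriMarkedDomain (2 * m + 1), ArcPoint D (Fin.last (2 * m))) => lawLP zz.2)
    (fun j hj zz => hstab j hj zz.1 zz.2) (i₀ := ⟨D₀, z₀⟩) (totalMass_lawLP_ne_zero z₀ hq₀)

/-- ★★★ **… AND FOR BOUNDARY SPAN** on the home arc. [cite: KhristoforovSmirnov2021, §2 eq. (4) and Remark 6 (arXiv v1 p. 5); RidoutSaintAubin2014TL, §3 Prop. 3.3 (arXiv p. 13)] -/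
theorem bSpan_of_laws_stable_corners
    (hstab : ∀ (j : Fin (2 * m + 1)), j.val < 2 * m → ∀ (D : TriMarkedDomain (2 * m + 1)) (z : ArcPoint D (Fin.last (2 * m))),
      tlL ℂ 1 j (lawLP z) ∈ Submodule.span ℂ (Set.range fun zz : (Σ D : TriMarkedDomain (2 * m + 1), ArcPoint D (Fin.last (2 * m))) => lawLP zz.2))
    (h0 : ∃ (D : TriMarkedDomain (2 * m + 1)) (z : ArcPoint D (Fin.last (2 * m))) (q : Pat₀ (2 * m + 1)), patternCount D z.v z.i q.1 ≠ 0) :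
    BSpan (2 * m + 1) (Fin.last (2 * m)) :=
  (bSpan_iff_bNonvanish _).2 (bNonvanish_of_laws_stable_corners hstab h0)

/-- ★★ **every arc** (`k = 2m+3 ≥ 3`): the corner-pair criterion on the home arc gives span and non-degeneracy on every arc.
[cite: KhristoforovSmirnov2021, §1.2 (arXiv v1 p. 2: cyclic indexing); §2 eq. (4) (p. 5); RidoutSaintAubin2014TL, §3 Prop. 3.3 (arXiv p. 13)] -/
theorem bSpan_of_laws_stable_corners' {m : ℕ}
    (hstab : ∀ (j : Fin (2 * (m + 1) + 1)), j.val < 2 * (m + 1) → ∀ (D : TriMarkedDomain (2 * (m + 1) + 1)) (z : ArcPoint D (Fin.last (2 * (m + 1)))),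
      tlL ℂ 1 j (lawLP z) ∈ Submodule.span ℂ (Set.range fun zz : (Σ D : TriMarkedDomain (2 * (m + 1) + 1), ArcPoint D (Fin.last (2 * (m + 1)))) => lawLP zz.2))
    (h0 : ∃ (D : TriMarkedDomain (2 * (m + 1) + 1)) (z : ArcPoint D (Fin.last (2 * (m + 1)))) (q : Pat₀ (2 * (m + 1) + 1)), patternCount D z.v z.i q.1 ≠ 0)
    (a : Fin (2 * (m + 1) + 1)) : BSpan (2 * (m + 1) + 1) a ∧ BNonvanish (2 * (m + 1) + 1) a := by
  have h := bNonvanish_of_laws_stable_corners hstab h0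
  have ha : BNonvanish (2 * (m + 1) + 1) a := (bNonvanish_iff (n := 2 * m + 1) a (Fin.last (2 * (m + 1)))).2 h
  exact ⟨(bSpan_iff_bNonvanish a).2 ha, ha⟩

end CornerCriterion

end Literature.Probability.Percolation.MarkedLoops
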